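import Summits.BirchSwinnertonDyer.BirchSwinnertonDyer.Theorems.AdditiveBranchIMCGordTwoRankOneUnitCoeff
import Summits.BirchSwinnertonDyer.BirchSwinnertonDyer.Theorems.AdditiveBranchIMCGordTwoRankZeroCongruenceCert
import HarnessLib

/-!
# Route `AdditiveBranchIMC` (rung K1), crux `GordTwoRankOne` (item 19358): the Λ-adic input (R1) AT THE PAIR
# from a CONGRUENT PARTNER (Emerton–Pollack–Weston 2006 Cor. 5.1.4 on the branch, k1-c2's road) — the rank-ONE
# consumers: lower half on cell (G-ord, `e = 2`), `BSD(E,p)` on X4♯(G-ord) ∩ {`ρ̄` onto} (cell `bsd-addord`, seat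
# `bsd-addord-k1-c3` gen 3, D-0074 row B2; `--supports stmt-BirchSwinnertonDyer-19358 --as helper`)

HONEST FRAMING. THEOREMS ONLY: no definition, no named fact, no `sorry`, nothing booked; BSD is not proved by any
of this; the crux stays OPEN at class level (residuals (R1) Λ-adic layer off Case-1 — NOT in print — and (R2)
`A′ ≠ 0` on non-CM pairs — Schneider, rider I1; TARGET E68/E74, H3). Published inputs are BINDERS: the reading
facts `hK` (Kato 2004 Thm. 17.4 (3) on the half eigenspace, `Wuthrich2014.kato_halfEigenCharIdeal_dvd_cyclotomicPrime_of_surjective`)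
and `hEPW` (`EmertonPollackWeston2006.cor514_branchTransfer_of_torsionIso`: Invent. Math. 163 (2006) Cor. 5.1.4 +
Thm. 5.1.3 on the branch `i = (p−1)/2`, typed by k1-c2, p429356), Pal 2012 Thm. 3.2 (`hPal`), and the cite-only
rank-one facts `hMaz hCyc hArt h73 hWald hDel hmod hmodD hmodN hGZK` of the seat's earlier files; the per-pair
CERTIFICATES are displayed and never asserted: (C1) a `Γ_ℚ`-equivariant `V₁[p] ≃ V[p]` from the partner `V₁` to
the good ordinary twist models `V` of `E`; (C2) the partner's branch statement 5.1.1 with `μ = 0`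
(`BranchCharIdealMuZeroEigen V₁ p`) — supplied in the tree from Kato + ONE unit constant term, or (C2′) from a
rank-`0` `p`-twist `E₁` of `V₁` with `ord_p (L(E₁,1)/Ω_{E₁}) = 0` (k1-c2 `…CongruenceCert`); (C3) `A′(E,p) ≠ 0`.

WHAT. k1-c2 (gen 2, p429691) proved `chiBranchLowerDivisibility[Odd]At_of_branchTransfer`: `hEPW` + a partner
`V₁` (good ordinary, `V₁[p]` irreducible, 5.1.1 with `μ = 0`) + (C1) ⟹ the Λ-adic lower input
`ChiBranchLowerDivisibility[Odd]At E p` at the additive pair — the rank-free layer (R1) of THIS crux at the pair —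
and consumed it in rank `0`. This file is the rank-ONE consumer: composed with gen 0's rank-one cores
(`cellGordTwo_missingLowerBoundAt_rankOne{,_odd}_…`: kernel `p`-adic Gross–Zagier identity + Delbourgo (A)+(B) +
Mazur's unit local index) and gen 3's BSTW-free X4♯ end (`classX4Gord_bsdp_rankOne_of_chiBranchLower_…`):

* §1 `cellGordTwo_missingLowerBoundAt_rankOne_of_facts_of_partner[_odd]` — cell (G-ord, `e = 2`), non-CM,
  `r_an = 1`, `p ≡ 1 (mod 4)` (resp. `≡ 3`, `p ≥ 7`): `ord_p #Ш(E)_an ≤ ord_p #Ш(E)` from the facts, `hEPW`, a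
  partner with (C1)+(C2), and (C3); `…_of_partner_of_liLiuTian` drops `¬CM` (CM rows by Li–Liu–Tian, gen 2).
* §2 `classX4Gord_bsdp_rankOne[_odd]_of_katoHalf_of_partner` — X4♯(G-ord) ∩ `I₀*` ∩ {`ρ̄` onto}: `BSD(E,p)`;
  `classX4Gord_bsdp_rankOne_of_katoHalf_of_partner_LValueUnit` — the same with (C2) READ OFF AN `L`-VALUE (C2′)
  at a tower-surjective partner (even branch; Kato's component reading derived from `hK` by the tree's
  `…_of_half` bridge).

REACH (honest, EPW Thm. 1 / §5): residual classes `ρ̄ = V[p]` (irreducible) with `μ(ρ̄, ω^{(p−1)/2}) = 0` and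
minimal `λ = 0` on the branch, witnessed by a RATIONAL weight-two member `V₁`; at `p = 5` partners abound
(Rubin–Silverberg families), at `p ≥ 7` they are sporadic; `p = 3` is outside EPW. This is the road for the
CONTENT rows (`v_p(A′) ≥ 1`), complementary to the one-certificate road of `…UnitCoeff.lean` (`v_p(A′) = 0`).

References: [EmertonPollackWeston2006] Cor. 5.1.4, Thm. 5.1.3, Thm. 5.1.2 (arXiv math/0404484 p. 30);
[Kato2004Asterisque] Thm. 17.4 (3); [Delbourgo2002] Thm. (A), (B); [Disegni2017] Thm. A, B; [Mazur1972Towers]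
Cor. 5.15; [Pal2012] Thm. 3.2; [MazurTateTeitelbaum1986Invent] §I.13–14; [LiLiuTian2024] Thm. 1.1 (i);
[Miller2011LMS] Def. 1.1; k1-c2 memo K1C2G2-EPW-BRANCH-ROAD-19357.md (item 19357 evidence).
-/

set_option autoImplicit false
set_option linter.dupNamespace false

noncomputable section

open scoped Classical MatrixGroups ModularForm NumberField

open CongruenceSubgroup WeierstrassCurve NumberField IsDedekindDomain Field
  Literature.NumberTheory.EllipticCurves Literature.NumberTheory.EllipticCurves.ModularForms
  Literature.NumberTheory.EllipticCurves.GreenbergVatsal2000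
  Literature.NumberTheory.EllipticCurves.EmertonPollackWeston2006
  Literature.NumberTheory.EllipticCurves.Rank1Residual
  Literature.NumberTheory.EllipticCurves.Rank1Residual.Typed
  Literature.NumberTheory.EllipticCurves.Delbourgo2002
  Literature.NumberTheory.EllipticCurves.Disegni2017
  Literature.NumberTheory.GaloisRepresentations
  Summit.BirchSwinnertonDyer.Rank1Residual.AdditivePotMult
  Summit.BirchSwinnertonDyer.Rank1Residual.Additive
  Summit.BirchSwinnertonDyer.BirchSwinnertonDyer.Theorems.AdditiveBranchIMCGordTwoRankZeroCongruence

namespace Summit.BirchSwinnertonDyer.BirchSwinnertonDyer.Theorems.AdditiveBranchIMCGordTwoRankOne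

variable {W : WeierstrassCurve ℚ} [W.IsElliptic] [W.IsGloballyMinimal] {p : ℕ} [hp : Fact p.Prime]

/-! ### §1 The lower half on cell (G-ord, `e = 2`) in analytic rank one, from a partner -/

/-- **Cell (G-ord, `e = 2`), `p ≡ 1 (mod 4)`, non-CM, `r_an(E) = 1`, ANY residual image: the LOWER half
`ord_p #Ш(E)_an ≤ ord_p #Ш(E)` from the published facts, EPW's branch transfer `hEPW`, a PARTNER `V₁` (globally
minimal, ordinary at `p`, `V₁[p]` irreducible, EPW 5.1.1 with `μ = 0` on the branch: `hBr₁`) with (C1) `hiso`, and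
(C3) `A′(E,p) ≠ 0`.** The Λ-adic input of gen 0's
`cellGordTwo_missingLowerBoundAt_rankOne_of_facts_of_chiBranchLower_of_branchCoeffOneNeZero` is k1-c2's
`chiBranchLowerDivisibilityAt_of_branchTransfer` (char_Λ `X(E/ℚ_∞) = (g)`, `ι g = ϖ·L_br`, at the pair). `p ≥ 5`
is automatic. CONDITIONAL on the displayed facts and certificates; closes nothing; books nothing.
[cite: EmertonPollackWeston2006, Cor. 5.1.4 and Thm. 5.1.3 (arXiv p30)] [cite: Delbourgo2002, Theorem (A), (B) (p. 40), p. 67 (iv), p. 69]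
[cite: Disegni2017, Theorem A/B (arXiv v3 PDF 7–9)] [cite: Mazur1972Towers, Cor. 5.15] [cite: Miller2011LMS, Def. 1.1] -/
theorem cellGordTwo_missingLowerBoundAt_rankOne_of_facts_of_partner
    (hMaz : Mazur1972.cor515_universalNormIndex) (hCyc : delbourgoDatum_cycLineGrossZagier)
    (hArt : rankinSelbergEulerProductHecke_baseChangeDirichlet_eq) (h73 : GrossZagier1986_thm_I_7_3)
    (hWald : waldspurger_exists_heegnerField_twist_ne_zero) (hDel : Delbourgo2002.mainTheorem)
    (hmod : hasEntireLFunction_rat) (hmodD : nonempty_modularParametrizationData)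
    (hmodN : exists_isNewformOf) (hGZK : rank_eq_analyticRank_of_analyticRank_le_one)
    (hEPW : EmertonPollackWeston2006.cor514_branchTransfer_of_torsionIso)
    (hc : N10.CellGordTwo W p) (hp4 : p % 4 = 1) (hcm : ¬ W.HasCM) (hr : W.analyticRank = 1)
    (V₁ : WeierstrassCurve ℚ) [V₁.IsElliptic] [V₁.IsGloballyMinimal]
    (hord₁ : IsOrdinaryAt V₁ p) (hirr₁ : V₁.HasIrreducibleModPGaloisRep p)
    (hBr₁ : BranchCharIdealMuZeroEigen V₁ p)
    (hiso : ∀ (V : WeierstrassCurve ℚ) [V.IsElliptic] [V.IsGloballyMinimal],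
      (∃ C : VariableChange ℚ, C • V.quadraticTwist (p : ℚ) = W) → GoodOrd V p →
      ∃ e : geomTorsion V₁ (p : ℤ) ≃+ geomTorsion V (p : ℤ),
        ∀ (σ : Field.absoluteGaloisGroup ℚ) (P : geomTorsion V₁ (p : ℤ)), e (σ • P) = σ • e P)
    (hne : BranchCoeffOneNeZeroAt W p) : MissingLowerBoundAt W p :=
  have hp5 : 5 ≤ p := by have := hp.out.two_le; omega
  cellGordTwo_missingLowerBoundAt_rankOne_of_facts_of_chiBranchLower_of_branchCoeffOneNeZero hMaz hCyc hArt
    h73 hWald hDel hmod hmodD hmodN hGZK hc hp4 hcm hr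
    (chiBranchLowerDivisibilityAt_of_branchTransfer hEPW hp5 (padicValRat_j_nonneg_of_typeGOrd W p hc.2.2.1)
      V₁ hord₁ hirr₁ hBr₁ hiso) hne

/-- **Odd twin: cell (G-ord, `e = 2`), `p ≡ 3 (mod 4)`, `p ≥ 7`, non-CM, `r_an(E) = 1`: the lower half from the
facts, `hEPW`, a partner with (C1) (twist by `−p = p*`) + (C2), and (C3)** — gen 0's odd core
`cellGordTwo_missingLowerBoundAt_rankOne_odd_…` (kernel identity p416794, minus symbols) with k1-c2's
`chiBranchLowerDivisibilityOddAt_of_branchTransfer`. Closes nothing.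
[cite: EmertonPollackWeston2006, Cor. 5.1.4 and Thm. 5.1.3 (arXiv p30)] [cite: Delbourgo2002, Theorem (A), (B) (p. 40)]
[cite: Mazur1972Towers, Cor. 5.15] [cite: Miller2011LMS, Def. 1.1] -/
theorem cellGordTwo_missingLowerBoundAt_rankOne_odd_of_facts_of_partner
    (hMaz : Mazur1972.cor515_universalNormIndex) (hCyc : delbourgoDatum_cycLineGrossZagier)
    (hArt : rankinSelbergEulerProductHecke_baseChangeDirichlet_eq) (h73 : GrossZagier1986_thm_I_7_3)
    (hWald : waldspurger_exists_heegnerField_twist_ne_zero) (hDel : Delbourgo2002.mainTheorem)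
    (hmod : hasEntireLFunction_rat) (hmodD : nonempty_modularParametrizationData)
    (hmodN : exists_isNewformOf) (hGZK : rank_eq_analyticRank_of_analyticRank_le_one)
    (hEPW : EmertonPollackWeston2006.cor514_branchTransfer_of_torsionIso)
    (hc : N10.CellGordTwo W p) (hp4 : p % 4 = 3) (hp5 : 5 ≤ p) (hcm : ¬ W.HasCM) (hr : W.analyticRank = 1)
    (V₁ : WeierstrassCurve ℚ) [V₁.IsElliptic] [V₁.IsGloballyMinimal]
    (hord₁ : IsOrdinaryAt V₁ p) (hirr₁ : V₁.HasIrreducibleModPGaloisRep p)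
    (hBr₁ : BranchCharIdealMuZeroEigen V₁ p)
    (hiso : ∀ (V : WeierstrassCurve ℚ) [V.IsElliptic] [V.IsGloballyMinimal],
      (∃ C : VariableChange ℚ, C • V.quadraticTwist (-(p : ℚ)) = W) → GoodOrd V p →
      ∃ e : geomTorsion V₁ (p : ℤ) ≃+ geomTorsion V (p : ℤ),
        ∀ (σ : Field.absoluteGaloisGroup ℚ) (P : geomTorsion V₁ (p : ℤ)), e (σ • P) = σ • e P)
    (hne : BranchCoeffOneNeZeroAt W p) : MissingLowerBoundAt W p :=
  cellGordTwo_missingLowerBoundAt_rankOne_odd_of_facts_of_chiBranchLowerOdd_of_branchCoeffOneNeZero hMaz hCyc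
    hArt h73 hWald hDel hmod hmodD hmodN hGZK hc hp4 hp5 hcm hr
    (chiBranchLowerDivisibilityOddAt_of_branchTransfer hEPW hp5 (padicValRat_j_nonneg_of_typeGOrd W p hc.2.2.1)
      V₁ hord₁ hirr₁ hBr₁ hiso) hne

/-- **The `¬CM` binder removed** (even branch): on a CM row of the cell the lower half is Li–Liu–Tian 2024 Thm.
1.1 (i) (gen 2's `missingLowerBoundAt_rankOne_of_typeGOrd_of_hasCM_of_liLiuTian`, binder `hLLT`), elsewhere the
previous theorem — so the certificate bundle (partner + (C1) + (C2) + (C3)) is asked with NO side condition on `E`.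
[cite: LiLiuTian2024, Thm. 1.1 (i)] [cite: EmertonPollackWeston2006, Cor. 5.1.4 (arXiv p30)] [cite: Miller2011LMS, Def. 1.1] -/
theorem cellGordTwo_missingLowerBoundAt_rankOne_of_facts_of_partner_of_liLiuTian
    (hMaz : Mazur1972.cor515_universalNormIndex) (hCyc : delbourgoDatum_cycLineGrossZagier)
    (hArt : rankinSelbergEulerProductHecke_baseChangeDirichlet_eq) (h73 : GrossZagier1986_thm_I_7_3)
    (hWald : waldspurger_exists_heegnerField_twist_ne_zero) (hDel : Delbourgo2002.mainTheorem)
    (hmod : hasEntireLFunction_rat) (hmodD : nonempty_modularParametrizationData)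
    (hmodN : exists_isNewformOf) (hGZK : rank_eq_analyticRank_of_analyticRank_le_one)
    (hLLT : LiLiuTian2024.thm11_bsdp_of_cm_rank_one)
    (hEPW : EmertonPollackWeston2006.cor514_branchTransfer_of_torsionIso)
    (hc : N10.CellGordTwo W p) (hp4 : p % 4 = 1) (hr : W.analyticRank = 1)
    (V₁ : WeierstrassCurve ℚ) [V₁.IsElliptic] [V₁.IsGloballyMinimal]
    (hord₁ : IsOrdinaryAt V₁ p) (hirr₁ : V₁.HasIrreducibleModPGaloisRep p)
    (hBr₁ : BranchCharIdealMuZeroEigen V₁ p)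
    (hiso : ∀ (V : WeierstrassCurve ℚ) [V.IsElliptic] [V.IsGloballyMinimal],
      (∃ C : VariableChange ℚ, C • V.quadraticTwist (p : ℚ) = W) → GoodOrd V p →
      ∃ e : geomTorsion V₁ (p : ℤ) ≃+ geomTorsion V (p : ℤ),
        ∀ (σ : Field.absoluteGaloisGroup ℚ) (P : geomTorsion V₁ (p : ℤ)), e (σ • P) = σ • e P)
    (hne : BranchCoeffOneNeZeroAt W p) : MissingLowerBoundAt W p := by
  by_cases hcm : W.HasCM
  · exact missingLowerBoundAt_rankOne_of_typeGOrd_of_hasCM_of_liLiuTian hLLT hc.1 hc.2.2.1 hcm hr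
  · exact cellGordTwo_missingLowerBoundAt_rankOne_of_facts_of_partner hMaz hCyc hArt h73 hWald hDel hmod hmodD
      hmodN hGZK hEPW hc hp4 hcm hr V₁ hord₁ hirr₁ hBr₁ hiso hne

/-! ### §2 `BSD(E,p)` on X4♯(G-ord) ∩ `I₀*` ∩ {`ρ̄_{E,p}` onto} in analytic rank one, from a partner -/

/-- **X4♯(G-ord) ∩ `I₀*` ∩ {`ρ̄_{E,p}` onto}, `p ≡ 1 (mod 4)`, `r_an(E) = 1`, anomalous or not: `BSD(E,p)` from the
published facts, Kato's half `hK`, EPW's branch transfer `hEPW`, a partner `V₁` with (C1) `hiso` + (C2) `hBr₁`, and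
(C3) `A′ ≠ 0`** — gen 3's BSTW-free end `classX4Gord_bsdp_rankOne_of_chiBranchLower_of_cycLineFact_of_katoHalf`
with its displayed Λ-adic input supplied by `chiBranchLowerDivisibilityAt_of_branchTransfer`. Both halves; `¬CM`
automatic (Serre). CONDITIONAL on the displayed facts and certificates; nothing booked.
[cite: EmertonPollackWeston2006, Cor. 5.1.4 and Thm. 5.1.3 (arXiv p30)] [cite: Kato2004Asterisque, Thm. 17.4 (3) (p. 273)]
[cite: Delbourgo2002, Theorem (A), (B) (p. 40)] [cite: Disegni2017, Theorem A/B (arXiv v3 PDF 7–9)] [cite: Miller2011LMS, Def. 1.1] -/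
theorem classX4Gord_bsdp_rankOne_of_katoHalf_of_partner
    (hMaz : Mazur1972.cor515_universalNormIndex) (hCyc : delbourgoDatum_cycLineGrossZagier)
    (hArt : rankinSelbergEulerProductHecke_baseChangeDirichlet_eq) (h73 : GrossZagier1986_thm_I_7_3)
    (hWald : waldspurger_exists_heegnerField_twist_ne_zero) (hDel : Delbourgo2002.mainTheorem)
    (hK : Wuthrich2014.kato_halfEigenCharIdeal_dvd_cyclotomicPrime_of_surjective)
    (hmod : hasEntireLFunction_rat) (hmodD : nonempty_modularParametrizationData)
    (hmodN : exists_isNewformOf) (hGZK : rank_eq_analyticRank_of_analyticRank_le_one)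
    (hEPW : EmertonPollackWeston2006.cor514_branchTransfer_of_torsionIso)
    (hX : ClassX4Gord W p) (he : semistabilityIndex W p = 2) (hp4 : p % 4 = 1) (hsurj : Surj W p)
    (hr : W.analyticRank = 1)
    (V₁ : WeierstrassCurve ℚ) [V₁.IsElliptic] [V₁.IsGloballyMinimal]
    (hord₁ : IsOrdinaryAt V₁ p) (hirr₁ : V₁.HasIrreducibleModPGaloisRep p)
    (hBr₁ : BranchCharIdealMuZeroEigen V₁ p)
    (hiso : ∀ (V : WeierstrassCurve ℚ) [V.IsElliptic] [V.IsGloballyMinimal],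
      (∃ C : VariableChange ℚ, C • V.quadraticTwist (p : ℚ) = W) → GoodOrd V p →
      ∃ e : geomTorsion V₁ (p : ℤ) ≃+ geomTorsion V (p : ℤ),
        ∀ (σ : Field.absoluteGaloisGroup ℚ) (P : geomTorsion V₁ (p : ℤ)), e (σ • P) = σ • e P)
    (hne : BranchCoeffOneNeZeroAt W p) : BSDp W p :=
  have hp5 : 5 ≤ p := by have := hp.out.two_le; omega
  classX4Gord_bsdp_rankOne_of_chiBranchLower_of_cycLineFact_of_katoHalf hMaz hCyc hArt h73 hWald hDel hK hmod
    hmodD hmodN hGZK hX he hp4 hsurj hr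
    (chiBranchLowerDivisibilityAt_of_branchTransfer hEPW hp5 (padicValRat_j_nonneg_of_typeGOrd W p hX.typeGOrd)
      V₁ hord₁ hirr₁ hBr₁ hiso) hne

/-- **Odd twin: X4♯(G-ord) ∩ `I₀*` ∩ {`ρ̄_{E,p}` onto}, `p ≡ 3 (mod 4)`, `p ≥ 7`, `r_an(E) = 1`: `BSD(E,p)` from the
facts, `hK`, `hEPW`, a partner with (C1) (twist by `−p`) + (C2), and (C3)** — gen 0's odd X4♯ end with k1-c2's
odd transfer; `¬CM` by Serre. Nothing booked.
[cite: EmertonPollackWeston2006, Cor. 5.1.4 and Thm. 5.1.3 (arXiv p30)] [cite: Kato2004Asterisque, Thm. 17.4 (3) (p. 273)]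
[cite: Delbourgo2002, Theorem (A), (B) (p. 40)] [cite: Miller2011LMS, Def. 1.1] -/
theorem classX4Gord_bsdp_rankOne_odd_of_katoHalf_of_partner
    (hMaz : Mazur1972.cor515_universalNormIndex) (hCyc : delbourgoDatum_cycLineGrossZagier)
    (hArt : rankinSelbergEulerProductHecke_baseChangeDirichlet_eq) (h73 : GrossZagier1986_thm_I_7_3)
    (hWald : waldspurger_exists_heegnerField_twist_ne_zero) (hDel : Delbourgo2002.mainTheorem)
    (hK : Wuthrich2014.kato_halfEigenCharIdeal_dvd_cyclotomicPrime_of_surjective)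
    (hmod : hasEntireLFunction_rat) (hmodD : nonempty_modularParametrizationData)
    (hmodN : exists_isNewformOf) (hGZK : rank_eq_analyticRank_of_analyticRank_le_one)
    (hEPW : EmertonPollackWeston2006.cor514_branchTransfer_of_torsionIso)
    (hX : ClassX4Gord W p) (he : semistabilityIndex W p = 2) (hp4 : p % 4 = 3) (hp5 : 5 ≤ p)
    (hsurj : Surj W p) (hr : W.analyticRank = 1)
    (V₁ : WeierstrassCurve ℚ) [V₁.IsElliptic] [V₁.IsGloballyMinimal]
    (hord₁ : IsOrdinaryAt V₁ p) (hirr₁ : V₁.HasIrreducibleModPGaloisRep p)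
    (hBr₁ : BranchCharIdealMuZeroEigen V₁ p)
    (hiso : ∀ (V : WeierstrassCurve ℚ) [V.IsElliptic] [V.IsGloballyMinimal],
      (∃ C : VariableChange ℚ, C • V.quadraticTwist (-(p : ℚ)) = W) → GoodOrd V p →
      ∃ e : geomTorsion V₁ (p : ℤ) ≃+ geomTorsion V (p : ℤ),
        ∀ (σ : Field.absoluteGaloisGroup ℚ) (P : geomTorsion V₁ (p : ℤ)), e (σ • P) = σ • e P)
    (hne : BranchCoeffOneNeZeroAt W p) : BSDp W p :=
  classX4Gord_bsdp_rankOne_odd_of_chiBranchLowerOdd_of_cycLineFact_of_katoHalf hMaz hCyc hArt h73 hWald hDel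
    hK hmod hmodD hmodN hGZK hX he hp4 hp5 (hX.not_hasCM_of_surj_of_five_le he hp5 hsurj) hsurj hr
    (chiBranchLowerDivisibilityOddAt_of_branchTransfer hEPW hp5
      (padicValRat_j_nonneg_of_typeGOrd W p hX.typeGOrd) V₁ hord₁ hirr₁ hBr₁ hiso) hne

/-- **THE BOOKABLE SHAPE ON A CONTENT ROW, even branch: `BSD(E,p)` from the facts, the two readings `hK`/`hEPW`,
Pal, and THREE per-pair certificates — (C1) a mod-`p` congruence to a tower-surjective partner `V₁`, (C2′) the
partner's globally minimal `p`-twist `E₁` (additive at `p`) is a rank-`0` pair with `ord_p (L(E₁,1)/Ω_{E₁}) = 0`, (C3)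
`A′(E,p) ≠ 0`.** X4♯(G-ord) ∩ `I₀*` ∩ {`ρ̄_{E,p}` onto}, `p ≡ 1 (mod 4)`, `r_an(E) = 1`. (C2) is k1-c2's
`branchCharIdealMuZeroEigen_of_katoComponent_of_LValueUnit` (Kato's COMPONENT reading, obtained from the half-eigen
reading `hK` by the tree's bridge `…_of_half`; Birch + Pal + MTT §I.14 for the constant term); `V₁[p]` irreducible
from `ρ̄_{V₁,p}` onto. In words: the lower half of `BSD(E,p)` in analytic rank ONE propagates along a mod-`p`
congruence from a rank-`0` additive pair where it is trivial, given `A′ ≠ 0` at `E`. Nothing booked.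
[cite: EmertonPollackWeston2006, Cor. 5.1.4 (arXiv p30)] [cite: Kato2004Asterisque, Thm. 17.4 (3) (p. 273)]
[cite: Pal2012, Thm. 3.2] [cite: MazurTateTeitelbaum1986Invent, §I.14] [cite: Delbourgo2002, Theorem (A), (B) (p. 40)]
[cite: Miller2011LMS, Def. 1.1] -/
theorem classX4Gord_bsdp_rankOne_of_katoHalf_of_partner_LValueUnit
    (hMaz : Mazur1972.cor515_universalNormIndex) (hCyc : delbourgoDatum_cycLineGrossZagier)
    (hArt : rankinSelbergEulerProductHecke_baseChangeDirichlet_eq) (h73 : GrossZagier1986_thm_I_7_3)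
    (hWald : waldspurger_exists_heegnerField_twist_ne_zero) (hDel : Delbourgo2002.mainTheorem)
    (hK : Wuthrich2014.kato_halfEigenCharIdeal_dvd_cyclotomicPrime_of_surjective)
    (hPal : Pal2012.thm32_sqrt_mul_realPeriodRat_twist_eq_of_prime_one_mod_four)
    (hmod : hasEntireLFunction_rat) (hmodD : nonempty_modularParametrizationData)
    (hmodN : exists_isNewformOf) (hGZK : rank_eq_analyticRank_of_analyticRank_le_one)
    (hEPW : EmertonPollackWeston2006.cor514_branchTransfer_of_torsionIso)
    (hX : ClassX4Gord W p) (he : semistabilityIndex W p = 2) (hp4 : p % 4 = 1) (hsurj : Surj W p)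
    (hr : W.analyticRank = 1)
    (V₁ E₁ : WeierstrassCurve ℚ) [V₁.IsElliptic] [V₁.IsGloballyMinimal] [E₁.IsElliptic]
    [E₁.IsGloballyMinimal] (hCW₁ : ∃ C : VariableChange ℚ, C • V₁.quadraticTwist (p : ℚ) = E₁)
    (hV₁ : GoodOrd V₁ p) (hsurj₁ : ∀ n : ℕ, V₁.HasSurjectiveModNGaloisRep (p ^ n : ℕ))
    (hadd₁ : Addv E₁ p) (hr₁ : E₁.analyticRank = 0)
    (hL₁ : ∃ q : ℚ, E₁.entireLFunction 1 = (q : ℂ) * (E₁.realPeriodRat : ℂ) ∧ padicValRat p q = 0)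
    (hiso : ∀ (V : WeierstrassCurve ℚ) [V.IsElliptic] [V.IsGloballyMinimal],
      (∃ C : VariableChange ℚ, C • V.quadraticTwist (p : ℚ) = W) → GoodOrd V p →
      ∃ e : geomTorsion V₁ (p : ℤ) ≃+ geomTorsion V (p : ℤ),
        ∀ (σ : Field.absoluteGaloisGroup ℚ) (P : geomTorsion V₁ (p : ℤ)), e (σ • P) = σ • e P)
    (hne : BranchCoeffOneNeZeroAt W p) : BSDp W p :=
  have hirr₁ : V₁.HasIrreducibleModPGaloisRep p :=
    hasIrreducibleModPGaloisRep_of_hasSurjectiveModNGaloisRep V₁ p (by simpa using hsurj₁ 1)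
  classX4Gord_bsdp_rankOne_of_katoHalf_of_partner hMaz hCyc hArt h73 hWald hDel hK hmod hmodD hmodN hGZK hEPW
    hX he hp4 hsurj hr V₁ ⟨hV₁.1, hV₁.2⟩ hirr₁
    (branchCharIdealMuZeroEigen_of_katoComponent_of_LValueUnit
      (Kato2004.charIdeal_dvd_padicLFunctionBranch_component_of_surjective_of_half hK) hPal hmod hp4 V₁ E₁
      hCW₁ hV₁ hsurj₁ hadd₁ hr₁ hL₁) hiso hne

end Summit.BirchSwinnertonDyer.BirchSwinnertonDyer.Theorems.AdditiveBranchIMCGordTwoRankOne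

end
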